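import Summits.CriticalPhenomena.PercolationContinuityZ3.Theorems.PercNearOneGluingNoHeavyLowerTailSahiGridPatternDiagCertCaterpillar
import Summits.CriticalPhenomena.PercolationContinuityZ3.Theorems.PercNearOneGluingNoHeavyLowerTailSahiGridPatternDiagRouteTopCubeCert

/-!
# `NoHeavyLowerTail` (crux stmt-CriticalPhenomena-4575), Sahi programme P1: **TOP-CUBE BLOCK ∧ CERTIFIED BLOCK** — the block-AND `S × V` of a
# top-cube up-set `S ⊆ {1,2}^n` with ANY diagonally certified `V` (in particular every caterpillar pattern) is diagonally certified, hence good in every dimension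

Support file (Sahi cell, seat `prim-sahi-p1`, generation 33; `--supports stmt-CriticalPhenomena-4575`).  Pure proofs, no definitions, no `sorry`,
standard axioms.  A two-line composition of generation 31's `diagCert_blockAnd_topCube` (Conjecture D: the diagonal plan `2^n·1_S ⊗ d` certifies `S × V`)
with this generation's `exists_diagCert_caterpillar` (every caterpillar read-once pattern carries a diagonal certificate), recorded so that the class
statement is citable by name:
* `exists_diagCert_blockAnd_topCube` — `S ⊆ [3]^n` an up-set with no zero coordinate, `V ⊆ [3]^k` an up-set with SOME diagonal certificate, `A = S × V`
  (`glue ξ z ∈ A ↔ ξ ∈ S ∧ z ∈ V`) ⟹ `A` has a diagonal certificate; `sStarD_cylSet_nonneg_of_exists_diagCert` — hence `A × [3]^m` is good for every `m`;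
* `exists_diagCert_topCube_caterpillar` / `sStarD_cylSet_topCube_caterpillar_nonneg` — the instance `V` = a caterpillar pattern in any position: e.g. the
  pattern of `[x₁ ≥ 1 ∧ x₂ ≥ 1 ∧ (x₁ = 2 ∨ x₂ = 2)] ∧ [x₃ ≥ 1 ∧ (x₄ = 2 ∨ (x₅ ≥ 1 ∧ x₆ ≥ 2))]` is a good first slot of the pattern functional in every
  dimension (first block: a non-principal top-cube up-set; second block: a caterpillar).
So the DIAGONALLY CERTIFIED class now provably contains: `⊤`, `∅`, orthants, top-cube up-sets and their cylinders (gen 16/19/22), every caterpillar pattern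
(gen 33), and is closed under the four one-axis literal steps (gen 28/33), free axes (`…DiagCertLift`) and `S × (·)` for top-cube `S` (gen 31).
Nothing here asserts `PatternPos d` for `d ≥ 4`. [this work]
-/

namespace Summit.CriticalPhenomena.PercolationContinuityZ3.Theorems.SahiGridPattern

open Finset SahiGrid3
open scoped BigOperators

variable {n k : ℕ} {S : Finset (Pd n)} {V : Finset (Pd k)} {A : Finset (Pd (n + k))}

/-- **Top-cube block ∧ certified block is certified**: if `S ⊆ [3]^n` is an up-set with no zero coordinate, `V ⊆ [3]^k` an up-set with a diagonal
certificate, and `A = S × V`, then `A` has a diagonal certificate (the diagonal plan `2^n·1_S ⊗ d`, generation 31). [this work] -/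
theorem exists_diagCert_blockAnd_topCube (hS : IsUpperSet (S : Set (Pd n))) (htop : ∀ ξ ∈ S, ∀ a, ξ a ≠ 0) (hV : IsUpperSet (V : Set (Pd k)))
    (hA : ∀ ξ z, glue ξ z ∈ A ↔ (ξ ∈ S ∧ z ∈ V))
    (hcert : ∃ d : Pd k → ℤ, (∀ q, 0 ≤ d q) ∧
      (∀ W : Finset (Pd k), IsUpperSet (W : Set (Pd k)) → (∑ q ∈ W, d q) ≤ ∑ q ∈ W, lamU V q) ∧
      (∀ X X' : Finset (Pd k), IsUpperSet (X : Set (Pd k)) → IsUpperSet (X' : Set (Pd k)) →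
        (∑ q ∈ X, ∑ r ∈ X', thetaVal V q r) ≤ ∑ q ∈ X ∩ X', d q)) :
    ∃ d' : Pd (n + k) → ℤ, (∀ x, 0 ≤ d' x) ∧
      (∀ W : Finset (Pd (n + k)), IsUpperSet (W : Set (Pd (n + k))) → (∑ x ∈ W, d' x) ≤ ∑ x ∈ W, lamU A x) ∧
      (∀ P Q : Finset (Pd (n + k)), IsUpperSet (P : Set (Pd (n + k))) → IsUpperSet (Q : Set (Pd (n + k))) →
        (∑ x ∈ P, ∑ y ∈ Q, thetaVal A x y) ≤ ∑ x ∈ P ∩ Q, d' x) := by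
  obtain ⟨d, hd, hT, hN⟩ := hcert
  exact ⟨_, diagCert_blockAnd_topCube hS htop hV hA d hd hT hN⟩

/-- A set with SOME diagonal certificate has all its cylinders good (existential packaging of `sStarD_cylSet_nonneg_of_diagCert`). [this work] -/
theorem sStarD_cylSet_nonneg_of_exists_diagCert {d₀ : ℕ} {U : Finset (Pd d₀)}
    (hcert : ∃ c : Pd d₀ → ℤ, (∀ q, 0 ≤ c q) ∧
      (∀ W : Finset (Pd d₀), IsUpperSet (W : Set (Pd d₀)) → (∑ q ∈ W, c q) ≤ ∑ q ∈ W, lamU U q) ∧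
      (∀ X X' : Finset (Pd d₀), IsUpperSet (X : Set (Pd d₀)) → IsUpperSet (X' : Set (Pd d₀)) →
        (∑ q ∈ X, ∑ r ∈ X', thetaVal U q r) ≤ ∑ q ∈ X ∩ X', c q))
    {m : ℕ} {B C : Finset (Pd (m + d₀))} (hB : IsUpperSet (B : Set (Pd (m + d₀)))) (hC : IsUpperSet (C : Set (Pd (m + d₀)))) :
    0 ≤ sStarD (cylSet U : Finset (Pd (m + d₀))) B C := by
  obtain ⟨c, hc, hT, hN⟩ := hcert
  exact sStarD_cylSet_nonneg_of_diagCert U c hc hT hN hB hC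

/-- **Top-cube block ∧ caterpillar block is certified**: `S ⊆ [3]^n` an up-set with no zero coordinate, `V ⊆ [3]^k` a caterpillar read-once pattern
in any position `σ`, `A = S × V` ⟹ `A` has a diagonal certificate. [this work] -/
theorem exists_diagCert_topCube_caterpillar (hS : IsUpperSet (S : Set (Pd n))) (htop : ∀ ξ ∈ S, ∀ a, ξ a ≠ 0)
    (K : ℕ) (ops : Fin K → Bool) (thr : Fin K → Option (Fin 3)) (w : Bool) (σ : Fin K → Fin k) (hσ : Function.Injective σ)
    (hVmem : ∀ y : Pd k, y ∈ V ↔ catEval K ops (fun i => litVal (thr i) (y (σ i))) w = true)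
    (hA : ∀ ξ z, glue ξ z ∈ A ↔ (ξ ∈ S ∧ z ∈ V)) :
    ∃ d' : Pd (n + k) → ℤ, (∀ x, 0 ≤ d' x) ∧
      (∀ W : Finset (Pd (n + k)), IsUpperSet (W : Set (Pd (n + k))) → (∑ x ∈ W, d' x) ≤ ∑ x ∈ W, lamU A x) ∧
      (∀ P Q : Finset (Pd (n + k)), IsUpperSet (P : Set (Pd (n + k))) → IsUpperSet (Q : Set (Pd (n + k))) →
        (∑ x ∈ P, ∑ y ∈ Q, thetaVal A x y) ≤ ∑ x ∈ P ∩ Q, d' x) :=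
  exists_diagCert_blockAnd_topCube hS htop (isUpperSet_caterpillar K ops thr w σ hVmem) hA
    (exists_diagCert_caterpillar K ops thr w k σ hσ V hVmem)

/-- **Hence good in every dimension**: with `S`, `V`, `A = S × V` as above (caterpillar second block), `0 ≤ sStarD (A × [3]^m) B C` for every `m`
and all up-sets `B, C`; for `m = 0` read `A × [3]^0 = A`. [this work] -/
theorem sStarD_cylSet_topCube_caterpillar_nonneg (hS : IsUpperSet (S : Set (Pd n))) (htop : ∀ ξ ∈ S, ∀ a, ξ a ≠ 0)
    (K : ℕ) (ops : Fin K → Bool) (thr : Fin K → Option (Fin 3)) (w : Bool) (σ : Fin K → Fin k) (hσ : Function.Injective σ)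
    (hVmem : ∀ y : Pd k, y ∈ V ↔ catEval K ops (fun i => litVal (thr i) (y (σ i))) w = true)
    (hA : ∀ ξ z, glue ξ z ∈ A ↔ (ξ ∈ S ∧ z ∈ V))
    {m : ℕ} {B C : Finset (Pd (m + (n + k)))} (hB : IsUpperSet (B : Set (Pd (m + (n + k))))) (hC : IsUpperSet (C : Set (Pd (m + (n + k))))) :
    0 ≤ sStarD (cylSet A : Finset (Pd (m + (n + k)))) B C :=
  sStarD_cylSet_nonneg_of_exists_diagCert (exists_diagCert_topCube_caterpillar hS htop K ops thr w σ hσ hVmem hA) hB hC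

/-- The same in the slot's own dimension: `0 ≤ sStarD A B C` for all up-sets `B, C ⊆ [3]^{n+k}`. [this work] -/
theorem sStarD_topCube_caterpillar_nonneg (hS : IsUpperSet (S : Set (Pd n))) (htop : ∀ ξ ∈ S, ∀ a, ξ a ≠ 0)
    (K : ℕ) (ops : Fin K → Bool) (thr : Fin K → Option (Fin 3)) (w : Bool) (σ : Fin K → Fin k) (hσ : Function.Injective σ)
    (hVmem : ∀ y : Pd k, y ∈ V ↔ catEval K ops (fun i => litVal (thr i) (y (σ i))) w = true)
    (hA : ∀ ξ z, glue ξ z ∈ A ↔ (ξ ∈ S ∧ z ∈ V))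
    {B C : Finset (Pd (n + k))} (hB : IsUpperSet (B : Set (Pd (n + k)))) (hC : IsUpperSet (C : Set (Pd (n + k)))) :
    0 ≤ sStarD A B C := by
  obtain ⟨d', _, hT, hN⟩ := exists_diagCert_topCube_caterpillar hS htop K ops thr w σ hσ hVmem hA
  exact sStarD_nonneg_of_diagCert A d' hT hN hB hC

end Summit.CriticalPhenomena.PercolationContinuityZ3.Theorems.SahiGridPattern
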